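import Literature.AnabelianGeometry.SemiGraphs.BTempQDPairQuotients
import Literature.AnabelianGeometry.SemiGraphs.TemperoidsGaloisTorsorProofs
import HarnessLib

/-!
# Semi-graphs of anabelioids, Appendix, proof of Theorem A.4: the first projection `B × B → B`
# forms a quotient of the QD-pair `(B × B, Aut(B))` for `B` Galois

Mochizuki, *Semi-graphs of anabelioids*, Publ. RIMS **42** (2006) 221–322, Appendix, proof of
Theorem A.4, manuscript pp. 85–86 (PRIMS p. 315 l. −8 – p. 316)
[cite: MochizukiSemiAnbd2006, Thm A.4 proof pp.85-86]: "Now let `B` be a connected object of `Q₂`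
such that `B × B` splits as a coproduct of copies of `B` [i.e., in other words, `B` is a connected
Galois object of `T₂` that admits a morphism in `T₂` to `A₂`] … Then if we let `Aut(B)` act on, say,
the second factor of `B × B`, then the resulting QD-pair `(B × B, Aut(B))` maps via `φ^*` to a QD-pair
`(φ^*(B) × φ^*(B), φ^*(Aut(B)))` of `Q₁`. Moreover, since the first projection `B × B → B` forms a
quotient of the former QD-pair, it follows that the first projection `φ^*(B) × φ^*(B) → φ^*(B)` forms
a quotient of the latter QD-pair."  (This is the step showing that `ψ^*` preserves terminal objects.)

Sub-node A4-T (core) of `plan/L3/SUBDAG-SemiAnbd-Cor311.md`, for the model temperoid `B^temp(Π)`: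

* `GaloisProduct.autSnd P hP : Aut B →* Aut P.pt` — `Aut(B)` acting on the second factor of ANY
  limit binary fan `P` of `B` with itself (in any category);
* **`GaloisProduct.isQuotient_fst_of_isGaloisObj`** — for `B` a Galois object of `B^temp(Π)`
  (Def. 3.1 (iv)) the first projection `P.fst : B × B → B` FORMS A QUOTIENT (Def. A.3 (iii)) of the
  QD-pair `(B × B, Aut(B))`: it is `Aut(B)`-invariant, surjective, and two pairs with the same first
  coordinate differ by an automorphism of the second (a Galois object is a torsor under its
  automorphisms, `GaloisTorsor.exists_aut_apply_eq_of_isGaloisObj`), so the criterion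
  `QDPair.isQuotient_iff_surjective` applies.

Elementary; nothing refers to the IUT corpus; no side is taken on any disputed claim.
-/

open CategoryTheory CategoryTheory.Limits Topology

namespace Literature.AnabelianGeometry.SemiGraphs

open Literature.AlgebraicGeometry.Frobenioids (IsConnectedObj IsNonemptyObj)
open Literature.AlgebraicGeometry.Frobenioids.QuasiTemperoid.BTempConnected (hom_ρ hom_ext_apply)

universe v w u

namespace GaloisProduct

/-! ### `Aut(B)` acting on the second factor of `B × B` -/

section AnyCategory

variable {C : Type w} [Category.{v} C] {B : C} (P : BinaryFan B B) (hP : IsLimit P)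

/-- The endomorphism `𝟙 × f` of a binary product cone `B × B` (any category). [cite: MochizukiSemiAnbd2006, Thm A.4 proof p.85] -/
def mapSnd (f : B ⟶ B) : P.pt ⟶ P.pt := hP.lift (BinaryFan.mk P.fst (P.snd ≫ f))

/-- `(𝟙 × f) ≫ fst = fst`. [cite: MochizukiSemiAnbd2006, Thm A.4 proof p.85] -/
@[simp] theorem mapSnd_fst (f : B ⟶ B) : mapSnd P hP f ≫ P.fst = P.fst :=
  hP.fac (BinaryFan.mk P.fst (P.snd ≫ f)) ⟨WalkingPair.left⟩

/-- `(𝟙 × f) ≫ snd = snd ≫ f`. [cite: MochizukiSemiAnbd2006, Thm A.4 proof p.85] -/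
@[simp] theorem mapSnd_snd (f : B ⟶ B) : mapSnd P hP f ≫ P.snd = P.snd ≫ f :=
  hP.fac (BinaryFan.mk P.fst (P.snd ≫ f)) ⟨WalkingPair.right⟩

/-- `𝟙 × 𝟙 = 𝟙`. [cite: MochizukiSemiAnbd2006, Thm A.4 proof p.85] -/
theorem mapSnd_id : mapSnd P hP (𝟙 B) = 𝟙 P.pt := by
  refine BinaryFan.IsLimit.hom_ext hP ?_ ?_
  · exact (mapSnd_fst P hP _).trans (Category.id_comp _).symm
  · exact ((mapSnd_snd P hP _).trans (Category.comp_id _)).trans (Category.id_comp _).symm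

/-- `(𝟙 × f) ≫ (𝟙 × g) = 𝟙 × (f ≫ g)`. [cite: MochizukiSemiAnbd2006, Thm A.4 proof p.85] -/
theorem mapSnd_comp (f g : B ⟶ B) : mapSnd P hP f ≫ mapSnd P hP g = mapSnd P hP (f ≫ g) := by
  refine BinaryFan.IsLimit.hom_ext hP ?_ ?_
  · rw [Category.assoc, mapSnd_fst, mapSnd_fst, mapSnd_fst]
  · rw [Category.assoc, mapSnd_snd, mapSnd_snd]
    exact ((reassoc_of% (mapSnd_snd P hP f)) g).trans (Category.assoc _ _ _)

/-- **`Aut(B)` acting on the second factor of `B × B`**: `σ ↦ 𝟙 × σ` as a group homomorphism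
`Aut(B) → Aut(B × B)` (print: "let `Aut(B)` act on, say, the second factor of `B × B`").
[cite: MochizukiSemiAnbd2006, Thm A.4 proof p.85] -/
noncomputable def autSnd : Aut B →* Aut P.pt where
  toFun σ :=
    { hom := mapSnd P hP σ.hom
      inv := mapSnd P hP σ.inv
      hom_inv_id := by rw [mapSnd_comp, σ.hom_inv_id, mapSnd_id]
      inv_hom_id := by rw [mapSnd_comp, σ.inv_hom_id, mapSnd_id] }
  map_one' := Iso.ext (mapSnd_id P hP)
  map_mul' σ τ := Iso.ext (by
    change mapSnd P hP (τ.hom ≫ σ.hom) = mapSnd P hP τ.hom ≫ mapSnd P hP σ.hom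
    rw [mapSnd_comp])

/-- The underlying arrow of `autSnd σ` is `𝟙 × σ`. [cite: MochizukiSemiAnbd2006, Thm A.4 proof p.85] -/
@[simp] theorem autSnd_hom (σ : Aut B) : (autSnd P hP σ).hom = mapSnd P hP σ.hom := rfl

end AnyCategory

/-! ### The first projection is a quotient of `(B × B, Aut(B))` for `B` Galois -/

section BTemp

variable {G : Type u} [Group G] [TopologicalSpace G]
  {B : BTemp G} (P : BinaryFan B B) (hP : IsLimit P)

/-- On points, `𝟙 × f` fixes the first coordinate. [cite: MochizukiSemiAnbd2006, Thm A.4 proof p.85] -/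
theorem fst_mapSnd_apply (f : B ⟶ B) (p : P.pt.obj.V) :
    (P.fst.hom.hom ((mapSnd P hP f).hom.hom p) : B.obj.V) = P.fst.hom.hom p :=
  congrArg (fun φ : P.pt ⟶ B => (φ.hom.hom p : B.obj.V)) (mapSnd_fst P hP f)

/-- On points, `𝟙 × f` applies `f` to the second coordinate. [cite: MochizukiSemiAnbd2006, Thm A.4 proof p.85] -/
theorem snd_mapSnd_apply (f : B ⟶ B) (p : P.pt.obj.V) :
    (P.snd.hom.hom ((mapSnd P hP f).hom.hom p) : B.obj.V) = f.hom.hom (P.snd.hom.hom p) :=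
  congrArg (fun φ : P.pt ⟶ B => (φ.hom.hom p : B.obj.V)) (mapSnd_snd P hP f)

variable [IsTopologicalGroup G]

/-- The QD-pair `(B × B, Aut(B))` of `B^temp(Π)` (`Aut(B)` on the second factor).
[cite: MochizukiSemiAnbd2006, Thm A.4 proof p.85] -/
noncomputable def pair : QDPair (BTemp G) := ⟨P.pt, (autSnd P hP).range⟩

/-- **Proof of Thm. A.4, the terminal-object step, core**: for `B` a Galois object of `B^temp(Π)`,
"the first projection `B × B → B` forms a quotient of the QD-pair `(B × B, Aut(B))`" — verified with
the criterion of `BTempQDPairQuotients`: `fst` is `Aut(B)`-invariant, surjective (diagonal points),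
and two points with the same first projection differ by `𝟙 × σ` for the automorphism `σ` of the
torsor `B` carrying one second coordinate to the other.
[cite: MochizukiSemiAnbd2006, Thm A.4 proof pp.85-86] -/
theorem isQuotient_fst_of_isGaloisObj (hB : IsGaloisObj B) : (pair P hP).IsQuotient P.fst := by
  refine ((pair P hP).isQuotient_iff_surjective P.fst).mpr ⟨?_, ?_, ?_⟩
  · -- (a) `Aut(B)`-invariance
    rintro γ ⟨σ, rfl⟩
    exact mapSnd_fst P hP σ.hom
  · -- surjective: the diagonal point over `b`
    intro b
    refine ⟨(hP.lift (BinaryFan.mk (𝟙 B) (𝟙 B))).hom.hom b, ?_⟩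
    exact congrArg (fun φ : B ⟶ B => (φ.hom.hom b : B.obj.V))
      (hP.fac (BinaryFan.mk (𝟙 B) (𝟙 B)) ⟨WalkingPair.left⟩)
  · -- fibres are `Aut(B)`-orbits
    intro p p' hpp'
    obtain ⟨σ, hσ⟩ := GaloisTorsor.exists_aut_apply_eq_of_isGaloisObj B hB
      (P.snd.hom.hom p) (P.snd.hom.hom p')
    refine ⟨autSnd P hP σ, ⟨σ, rfl⟩, ?_⟩
    refine GaloisTorsor.binaryFan_ext P hP _ _ ?_ ?_
    · exact (fst_mapSnd_apply P hP σ.hom p).trans hpp'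
    · exact (snd_mapSnd_apply P hP σ.hom p).trans hσ

/-- Hence, for `B` Galois, `B × B → (B × B)/Aut(B)` followed by the induced map is `fst` up to the
unique isomorphism `(B × B)/Aut(B) ≅ B` under `B × B` (Def. A.3 (iii) uniqueness).
[cite: MochizukiSemiAnbd2006, Thm A.4 proof pp.85-86] -/
theorem existsUnique_iso_orbitQuotient_of_isGaloisObj (hB : IsGaloisObj B) :
    ∃! e : (pair P hP).orbitQuotient ≅ B, (pair P hP).orbitQuotientπ ≫ e.hom = P.fst :=
  (isQuotient_fst_of_isGaloisObj P hP hB).existsUnique_iso_orbitQuotient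

end BTemp

end GaloisProduct

end Literature.AnabelianGeometry.SemiGraphs
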